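import Summits.CriticalPhenomena.PercolationContinuityZ3.Theorems.PercNearOneGluingNoHeavyLowerTailSunflowerCoverGraded
import Summits.CriticalPhenomena.PercolationContinuityZ3.Theorems.PercNearOneGluingNoHeavyLowerTailSunflowerLSMCalculus

/-!
# `NoHeavyLowerTail` (crux stmt-CriticalPhenomena-4575), abstract sunflower cubic: THE COVER CALCULUS
# (leaves; conjunction and disjunction on disjoint blocks)

Support file (seat `prim-ineq-prove-1` gen 36; `--supports stmt-CriticalPhenomena-4575`).  No `sorry`, no named facts.
Memo: run/shared/lean/prim/prim-ineq-prove-1/FINDING-COVER-prove1-g36.md §3 (THEOREM 2).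

SETTING (as `…SunflowerCoverGraded`): `Cover p a 𝒯` is the cover property of a family `𝒯` on the block `a`.  A COVER FAMILY
for the event `A` on the block `a` (`CovFam p a A 𝒯`) is a family of bad subsets of the block covering every bad missing set, with
the cover property and `famIn p a 𝒯 ∅ > 0`.
* `cover_leaf`, `covFam_leaf` — leaves `{ω | e ∈ ω}` with the family `{{e}}` (`0 < p_e`).
* `cover_and`, `covFam_and` — CONJUNCTION on disjoint blocks: the family `𝒯 ∪ 𝒮` (product formula `famIn_and`).
* `famIn_or`, `famIn_or_empty`, **`cover_or`**, `covFam_or` — DISJUNCTION on disjoint blocks: the family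
  `orFam 𝒯 𝒮 = {C ∪ D}`.  PROOF of `cover_or` (the heart of the memo): condition on the first block,
  `famIn p (a ∪ b) (orFam 𝒯 𝒮) (S k) = BEx p a (g k)` with `g k T₁ = famIn p b 𝒮 {D : C ∪ D ∈ S k for all C ∈ 𝒯 inside T₁}`;
  the `g k` are antitone, `≥ h₂ := famIn p b 𝒮 ∅`, and at a bad `T₁ ⊇ C₀` the inner families inherit the multiplicity bound
  (`D ↦ C₀ ∪ D`), so `∏_k g k T₁ ≤ h₂^(K−m)` by `Cover p b 𝒮`; THEOREM 1 in capacity form (`prod_BEx_le_of_cover`, floor `h₂`)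
  gives `∏_k famIn (S k) ≤ (h₁ + (1−h₁)h₂)^(K−m) = famIn p (a∪b) (orFam 𝒯 𝒮) ∅ ^ (K−m)`.
* `gsafe_of_covFam` — a cover family makes the event gradedly safe (wrapper of `gsafe_of_cover`).
Consequence (`…SunflowerCoverReadOnce`): every read-once core has a cover family, hence is gradedly safe and safe.
-/

noncomputable section

namespace Summit.CriticalPhenomena.PercolationContinuityZ3.Theorems.SunflowerPartition

namespace SafeCalc

open MeasureTheory Finset
open Literature.Probability.LatticeModels Literature.Probability.Percolation
open TwoGenCore (wmiss)

variable {ι : Type*} [DecidableEq ι] (p : ι → unitInterval)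

/-- A **cover family** for the event `A` on the block `a`: members inside the block, all bad, covering every bad missing set,
with the cover property and positive probability of the good event. [this work] -/
def CovFam (a : Finset ι) (A : Set (Set ι)) (𝒯 : Finset (Finset ι)) : Prop :=
  (∀ C ∈ 𝒯, C ⊆ a) ∧ (∀ C ∈ 𝒯, ((a \ C : Finset ι) : Set ι) ∉ A) ∧
    (∀ T, T ⊆ a → ((a \ T : Finset ι) : Set ι) ∉ A → ∃ C ∈ 𝒯, C ⊆ T) ∧ Cover p a 𝒯 ∧ 0 < famIn p a 𝒯 ∅

/-- A cover family makes an up-set determined by the block gradedly safe. [this work] -/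
theorem gsafe_of_covFam [Fintype ι] {a : Finset ι} {A : Set (Set ι)} {𝒯 : Finset (Finset ι)}
    (hd : DeterminedBy A (↑a : Set ι)) (hu : IsUpperSet A) (h : CovFam p a A 𝒯) : GSafe p a A := by
  have hbad' : ∀ C ∈ 𝒯, ∀ T, T ⊆ a → C ⊆ T → ((a \ T : Finset ι) : Set ι) ∉ A := by
    intro C hC T hT hCT hTA
    refine h.2.1 C hC (hu ?_ hTA)
    intro e he
    rw [Finset.mem_coe, Finset.mem_sdiff] at he ⊢
    exact ⟨he.1, fun h => he.2 (hCT h)⟩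
  have hh : famIn p a 𝒯 ∅ = (prodBernoulli p).real A := famIn_empty p a hd 𝒯 hbad' h.2.2.1
  exact gsafe_of_cover p a hd hu (hh ▸ h.2.2.2.2) 𝒯 h.1 h.2.1 h.2.2.1 h.2.2.2.1

/-! ## Leaves -/

/-- For the leaf family, the good event has probability `p_e`. [this work] -/
theorem famIn_leaf_empty (e : ι) : famIn p {e} {{e}} ∅ = (p e : ℝ) := by
  unfold famIn
  rw [BEx_single]
  have h1 : (∀ C ∈ ({{e}} : Finset (Finset ι)), C ⊆ (∅ : Finset ι) → C ∈ (∅ : Finset (Finset ι))) := by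
    intro C hC hCe
    rw [mem_singleton] at hC
    rw [hC] at hCe
    exact absurd (hCe (mem_singleton_self e)) (notMem_empty e)
  have h2 : ¬ (∀ C ∈ ({{e}} : Finset (Finset ι)), C ⊆ ({e} : Finset ι) → C ∈ (∅ : Finset (Finset ι))) :=
    fun h => absurd (h {e} (mem_singleton_self _) subset_rfl) (notMem_empty _)
  rw [if_pos h1, if_neg h2]; ring

/-- **Leaves have the cover property.** [this work] -/
theorem cover_leaf (e : ι) : Cover p {e} {{e}} := by
  classical
  intro K m S hS
  have hval : ∀ k, famIn p {e} {{e}} (S k) = if {e} ∈ S k then 1 else (p e : ℝ) := by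
    intro k; rw [famIn_single, famIn_leaf_empty]
  rw [prod_congr rfl fun k _ => hval k, famIn_leaf_empty, prod_ite, prod_const_one, one_mul, prod_const]
  have hcard : K - m ≤ (univ.filter fun k : Fin K => ¬ {e} ∈ S k).card := by
    have h1 := Finset.card_filter_add_card_filter_not (s := (univ : Finset (Fin K))) (fun k => {e} ∈ S k)
    rw [card_univ, Fintype.card_fin] at h1
    have h2 := hS {e} (mem_singleton_self _)
    omega
  exact pow_le_pow_of_le_one (p e).2.1 (p e).2.2 hcard

/-- **Leaves**: `{ω | e ∈ ω}` on the block `{e}` has the cover family `{{e}}` when `0 < p_e`. [this work] -/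
theorem covFam_leaf {e : ι} (he : 0 < (p e : ℝ)) : CovFam p {e} {ω | e ∈ ω} {{e}} := by
  obtain ⟨h1, h2, h3, _⟩ := lsmFam_leaf p e
  refine ⟨h1, h2, h3, cover_leaf p e, ?_⟩
  rw [famIn_leaf_empty]; exact he

/-! ## Conjunction on disjoint blocks -/

/-- **The cover property is closed under conjunction on disjoint blocks** (family `𝒯 ∪ 𝒮`). [this work] -/
theorem cover_and {a b : Finset ι} (hab : Disjoint a b) {𝒯 𝒮 : Finset (Finset ι)} (h𝒯 : ∀ C ∈ 𝒯, C ⊆ a)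
    (h𝒮 : ∀ C ∈ 𝒮, C ⊆ b) (hT : Cover p a 𝒯) (hS : Cover p b 𝒮) : Cover p (a ∪ b) (𝒯 ∪ 𝒮) := by
  intro K m S hmult
  rw [prod_congr rfl fun k _ => famIn_and p hab h𝒯 h𝒮 (S k), famIn_and p hab h𝒯 h𝒮 ∅, prod_mul_distrib, mul_pow]
  exact mul_le_mul (hT K m S fun C hC => hmult C (mem_union_left _ hC))
    (hS K m S fun C hC => hmult C (mem_union_right _ hC))
    (prod_nonneg fun k _ => famIn_nonneg p b 𝒮 _) (pow_nonneg (famIn_nonneg p a 𝒯 _) _)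

/-- Structural clauses for a conjunction on disjoint blocks: members inside the block, bad, covering. [this work] -/
theorem clauses_and {a b : Finset ι} {A B : Set (Set ι)} {𝒯 𝒮 : Finset (Finset ι)}
    (hdA : DeterminedBy A (↑a : Set ι)) (hdB : DeterminedBy B (↑b : Set ι))
    (hTa : ∀ C ∈ 𝒯, C ⊆ a) (hTbad : ∀ C ∈ 𝒯, ((a \ C : Finset ι) : Set ι) ∉ A)
    (hTcov : ∀ T, T ⊆ a → ((a \ T : Finset ι) : Set ι) ∉ A → ∃ C ∈ 𝒯, C ⊆ T)
    (hSb : ∀ C ∈ 𝒮, C ⊆ b) (hSbad : ∀ C ∈ 𝒮, ((b \ C : Finset ι) : Set ι) ∉ B)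
    (hScov : ∀ T, T ⊆ b → ((b \ T : Finset ι) : Set ι) ∉ B → ∃ C ∈ 𝒮, C ⊆ T) :
    (∀ C ∈ 𝒯 ∪ 𝒮, C ⊆ a ∪ b) ∧ (∀ C ∈ 𝒯 ∪ 𝒮, (((a ∪ b) \ C : Finset ι) : Set ι) ∉ A ∩ B) ∧
      (∀ T, T ⊆ a ∪ b → (((a ∪ b) \ T : Finset ι) : Set ι) ∉ A ∩ B → ∃ C ∈ 𝒯 ∪ 𝒮, C ⊆ T) := by
  refine ⟨fun C hC => ?_, fun C hC => ?_, fun T hT hbad => ?_⟩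
  · rcases mem_union.1 hC with h | h
    · exact (hTa C h).trans subset_union_left
    · exact (hSb C h).trans subset_union_right
  · rcases mem_union.1 hC with h | h
    · intro hmem
      have h1 := (mem_iff_of_determinedBy (b := b) hdA).1 hmem.1
      rw [inter_eq_left.2 (hTa C h)] at h1
      exact hTbad C h h1
    · intro hmem
      have h1 := (mem_iff_of_determinedBy (b := a) hdB).1 (by rw [union_comm]; exact hmem.2)
      rw [inter_eq_left.2 (hSb C h)] at h1
      exact hSbad C h h1
  · rw [Set.mem_inter_iff, not_and_or] at hbad
    rcases hbad with hA' | hB'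
    · have h1 : ((a \ (T ∩ a) : Finset ι) : Set ι) ∉ A := fun h => hA' ((mem_iff_of_determinedBy (b := b) hdA).2 h)
      obtain ⟨C, hC, hCT⟩ := hTcov (T ∩ a) inter_subset_right h1
      exact ⟨C, mem_union_left _ hC, hCT.trans inter_subset_left⟩
    · have h1 : ((b \ (T ∩ b) : Finset ι) : Set ι) ∉ B := fun h =>
        hB' (by rw [union_comm]; exact (mem_iff_of_determinedBy (b := a) hdB).2 h)
      obtain ⟨C, hC, hCT⟩ := hScov (T ∩ b) inter_subset_right h1
      exact ⟨C, mem_union_right _ hC, hCT.trans inter_subset_left⟩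

/-- **Conjunction**: cover families on disjoint blocks combine. [this work] -/
theorem covFam_and {a b : Finset ι} (hab : Disjoint a b) {A B : Set (Set ι)} {𝒯 𝒮 : Finset (Finset ι)}
    (hdA : DeterminedBy A (↑a : Set ι)) (hdB : DeterminedBy B (↑b : Set ι))
    (hA : CovFam p a A 𝒯) (hB : CovFam p b B 𝒮) : CovFam p (a ∪ b) (A ∩ B) (𝒯 ∪ 𝒮) := by
  obtain ⟨hTa, hTbad, hTcov, hTc, hTpos⟩ := hA
  obtain ⟨hSb, hSbad, hScov, hSc, hSpos⟩ := hB
  obtain ⟨h1, h2, h3⟩ := clauses_and hdA hdB hTa hTbad hTcov hSb hSbad hScov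
  refine ⟨h1, h2, h3, cover_and p hab hTa hSb hTc hSc, ?_⟩
  rw [famIn_and p hab hTa hSb]
  exact mul_pos hTpos hSpos

/-! ## Disjunction on disjoint blocks -/

/-- The family of a disjunction: all unions `C ∪ D`, `C ∈ 𝒯`, `D ∈ 𝒮`. [this work] -/
def orFam (𝒯 𝒮 : Finset (Finset ι)) : Finset (Finset ι) := (𝒯 ×ˢ 𝒮).image fun CD => CD.1 ∪ CD.2

/-- Membership in `orFam`. [this work] -/
theorem mem_orFam {𝒯 𝒮 : Finset (Finset ι)} {P : Finset ι} : P ∈ orFam 𝒯 𝒮 ↔ ∃ C ∈ 𝒯, ∃ D ∈ 𝒮, C ∪ D = P := by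
  unfold orFam
  rw [mem_image]
  constructor
  · rintro ⟨⟨C, D⟩, hCD, rfl⟩
    rw [mem_product] at hCD
    exact ⟨C, hCD.1, D, hCD.2, rfl⟩
  · rintro ⟨C, hC, D, hD, rfl⟩
    exact ⟨(C, D), mem_product.2 ⟨hC, hD⟩, rfl⟩

/-- On disjoint blocks, `C ∪ D ⊆ T₁ ∪ T₂` splits. [this work] -/
theorem union_subset_union_iff {a b : Finset ι} (hab : Disjoint a b) {C D T₁ T₂ : Finset ι} (hC : C ⊆ a) (hD : D ⊆ b)
    (hT₁ : T₁ ⊆ a) (hT₂ : T₂ ⊆ b) : C ∪ D ⊆ T₁ ∪ T₂ ↔ C ⊆ T₁ ∧ D ⊆ T₂ := by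
  constructor
  · intro h
    constructor
    · intro x hx
      rcases mem_union.1 (h (mem_union_left _ hx)) with h' | h'
      · exact h'
      · exact absurd (hT₂ h') (Finset.disjoint_left.1 hab (hC hx))
    · intro x hx
      rcases mem_union.1 (h (mem_union_right _ hx)) with h' | h'
      · exact absurd (hT₁ h') (Finset.disjoint_right.1 hab (hD hx))
      · exact h'
  · rintro ⟨h1, h2⟩
    exact union_subset_union h1 h2

/-- **Conditioning a disjunction on its first block**: `famIn p (a ∪ b) (orFam 𝒯 𝒮) 𝒰 = BEx p a (g)` with
`g T₁ = famIn p b 𝒮 {D ∈ 𝒮 : C ∪ D ∈ 𝒰 for every C ∈ 𝒯 inside T₁}`. [this work] -/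
theorem famIn_or {a b : Finset ι} (hab : Disjoint a b) {𝒯 𝒮 : Finset (Finset ι)} (h𝒯 : ∀ C ∈ 𝒯, C ⊆ a)
    (h𝒮 : ∀ D ∈ 𝒮, D ⊆ b) (𝒰 : Finset (Finset ι)) :
    famIn p (a ∪ b) (orFam 𝒯 𝒮) 𝒰 =
      BEx p a (fun T₁ => famIn p b 𝒮 (𝒮.filter fun D => ∀ C ∈ 𝒯, C ⊆ T₁ → C ∪ D ∈ 𝒰)) := by
  unfold famIn
  rw [BEx_union p hab]
  refine sum_congr rfl fun T₁ hT₁ => ?_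
  rw [mem_powerset] at hT₁
  congr 1
  refine sum_congr rfl fun T₂ hT₂ => ?_
  rw [mem_powerset] at hT₂
  congr 1
  have hiff : (∀ P ∈ orFam 𝒯 𝒮, P ⊆ T₁ ∪ T₂ → P ∈ 𝒰) ↔
      (∀ D ∈ 𝒮, D ⊆ T₂ → D ∈ 𝒮.filter fun D => ∀ C ∈ 𝒯, C ⊆ T₁ → C ∪ D ∈ 𝒰) := by
    constructor
    · intro h D hD hDT
      rw [mem_filter]
      refine ⟨hD, fun C hC hCT => h _ (mem_orFam.2 ⟨C, hC, D, hD, rfl⟩) (union_subset_union hCT hDT)⟩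
    · intro h P hP hPT
      obtain ⟨C, hC, D, hD, rfl⟩ := mem_orFam.1 hP
      obtain ⟨hCT, hDT⟩ := (union_subset_union_iff hab (h𝒯 C hC) (h𝒮 D hD) hT₁ hT₂).1 hPT
      exact (mem_filter.1 (h D hD hDT)).2 C hC hCT
  simp only [hiff]

/-- The good event of a disjunction: `famIn p (a∪b) (orFam 𝒯 𝒮) ∅ = h₁ + (1 − h₁) h₂`. [this work] -/
theorem famIn_or_empty {a b : Finset ι} (hab : Disjoint a b) {𝒯 𝒮 : Finset (Finset ι)} (h𝒯 : ∀ C ∈ 𝒯, C ⊆ a)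
    (h𝒮 : ∀ D ∈ 𝒮, D ⊆ b) :
    famIn p (a ∪ b) (orFam 𝒯 𝒮) ∅ = famIn p a 𝒯 ∅ + (1 - famIn p a 𝒯 ∅) * famIn p b 𝒮 ∅ := by
  rw [famIn_or p hab h𝒯 h𝒮]
  have hpt : ∀ T₁ : Finset ι, famIn p b 𝒮 (𝒮.filter fun D => ∀ C ∈ 𝒯, C ⊆ T₁ → C ∪ D ∈ (∅ : Finset (Finset ι))) =
      famIn p b 𝒮 ∅ + (1 - famIn p b 𝒮 ∅) *
        (if ∀ C ∈ 𝒯, C ⊆ T₁ → C ∈ (∅ : Finset (Finset ι)) then (1 : ℝ) else 0) := by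
    intro T₁
    by_cases hgood : ∀ C ∈ 𝒯, C ⊆ T₁ → C ∈ (∅ : Finset (Finset ι))
    · rw [if_pos hgood]
      have : (𝒮.filter fun D => ∀ C ∈ 𝒯, C ⊆ T₁ → C ∪ D ∈ (∅ : Finset (Finset ι))) = 𝒮 := by
        refine filter_true_of_mem fun D _ C hC hCT => ?_
        exact absurd (hgood C hC hCT) (notMem_empty C)
      rw [this, famIn_self]; ring
    · rw [if_neg hgood]
      push Not at hgood
      obtain ⟨C, hC, hCT, _⟩ := hgood
      have : (𝒮.filter fun D => ∀ C ∈ 𝒯, C ⊆ T₁ → C ∪ D ∈ (∅ : Finset (Finset ι))) = ∅ := by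
        refine filter_false_of_mem fun D _ h => ?_
        exact absurd (h C hC hCT) (notMem_empty _)
      rw [this]; ring
  simp only [hpt]
  rw [BEx_affine]
  unfold famIn
  ring

/-- **The cover property is closed under disjunction on disjoint blocks** (THEOREM 2 of the memo). [this work] -/
theorem cover_or {a b : Finset ι} (hab : Disjoint a b) {𝒯 𝒮 : Finset (Finset ι)} (h𝒯 : ∀ C ∈ 𝒯, C ⊆ a)
    (h𝒮 : ∀ D ∈ 𝒮, D ⊆ b) (hT : Cover p a 𝒯) (hS : Cover p b 𝒮)
    (h1 : 0 < famIn p a 𝒯 ∅) (h2 : 0 < famIn p b 𝒮 ∅) : Cover p (a ∪ b) (orFam 𝒯 𝒮) := by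
  classical
  intro K m S hmult
  let fil : Fin K → Finset ι → Finset (Finset ι) := fun k T₁ => 𝒮.filter fun D => ∀ C ∈ 𝒯, C ⊆ T₁ → C ∪ D ∈ S k
  let g : Fin K → Finset ι → ℝ := fun k T₁ => famIn p b 𝒮 (fil k T₁)
  have hrepr : ∀ k, famIn p (a ∪ b) (orFam 𝒯 𝒮) (S k) = BEx p a (g k) := fun k => famIn_or p hab h𝒯 h𝒮 (S k)
  have hanti : ∀ k, ∀ T T' : Finset ι, T ⊆ T' → T' ⊆ a → g k T' ≤ g k T := by
    intro k T T' hTT' _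
    refine famIn_mono p b 𝒮 fun D hD => ?_
    simp only [fil, mem_filter] at hD ⊢
    exact ⟨hD.1, fun C hC hCT => hD.2 C hC (hCT.trans hTT')⟩
  have hle1 : ∀ k, ∀ T : Finset ι, T ⊆ a → g k T ≤ 1 := fun k T _ => famIn_le_one p b 𝒮 _
  have hge : ∀ k, ∀ T : Finset ι, T ⊆ a → famIn p b 𝒮 ∅ ≤ g k T := fun k T _ =>
    famIn_mono p b 𝒮 (empty_subset _)
  have hbadG : ∀ T : Finset ι, T ⊆ a → (∃ C ∈ 𝒯, C ⊆ T) → ∏ k, g k T ≤ famIn p b 𝒮 ∅ ^ (K - m) := by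
    rintro T hT ⟨C₀, hC₀, hC₀T⟩
    refine hS K m (fun k => fil k T) fun D hD => ?_
    refine le_trans (card_le_card fun k hk => ?_) (hmult (C₀ ∪ D) (mem_orFam.2 ⟨C₀, hC₀, D, hD, rfl⟩))
    simp only [fil, mem_filter, mem_univ, true_and] at hk ⊢
    exact hk.2 C₀ hC₀ hC₀T
  have key := prod_BEx_le_of_cover p a 𝒯 h𝒯 hT h1 (n := K) (m := m) h2 (famIn_le_one p b 𝒮 ∅) g
    hanti hle1 hge hbadG
  rw [prod_congr rfl fun k _ => hrepr k, famIn_or_empty p hab h𝒯 h𝒮]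
  exact key

/-- Structural clauses for a disjunction on disjoint blocks: members inside the block, bad, covering. [this work] -/
theorem clauses_or {a b : Finset ι} (hab : Disjoint a b) {A B : Set (Set ι)} {𝒯 𝒮 : Finset (Finset ι)}
    (hdA : DeterminedBy A (↑a : Set ι)) (hdB : DeterminedBy B (↑b : Set ι))
    (hTa : ∀ C ∈ 𝒯, C ⊆ a) (hTbad : ∀ C ∈ 𝒯, ((a \ C : Finset ι) : Set ι) ∉ A)
    (hTcov : ∀ T, T ⊆ a → ((a \ T : Finset ι) : Set ι) ∉ A → ∃ C ∈ 𝒯, C ⊆ T)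
    (hSb : ∀ C ∈ 𝒮, C ⊆ b) (hSbad : ∀ C ∈ 𝒮, ((b \ C : Finset ι) : Set ι) ∉ B)
    (hScov : ∀ T, T ⊆ b → ((b \ T : Finset ι) : Set ι) ∉ B → ∃ C ∈ 𝒮, C ⊆ T) :
    (∀ P ∈ orFam 𝒯 𝒮, P ⊆ a ∪ b) ∧ (∀ P ∈ orFam 𝒯 𝒮, (((a ∪ b) \ P : Finset ι) : Set ι) ∉ A ∪ B) ∧
      (∀ T, T ⊆ a ∪ b → (((a ∪ b) \ T : Finset ι) : Set ι) ∉ A ∪ B → ∃ P ∈ orFam 𝒯 𝒮, P ⊆ T) := by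
  refine ⟨fun P hP => ?_, fun P hP => ?_, fun T hT hbad => ?_⟩
  · obtain ⟨C, hC, D, hD, rfl⟩ := mem_orFam.1 hP
    exact union_subset_union (hTa C hC) (hSb D hD)
  · obtain ⟨C, hC, D, hD, rfl⟩ := mem_orFam.1 hP
    have hCa : (C ∪ D) ∩ a = C := by
      ext x; simp only [mem_inter, mem_union]
      constructor
      · rintro ⟨hx | hx, hxa⟩
        · exact hx
        · exact absurd hxa (Finset.disjoint_right.1 hab (hSb D hD hx))
      · intro hx; exact ⟨Or.inl hx, hTa C hC hx⟩
    have hDb : (C ∪ D) ∩ b = D := by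
      ext x; simp only [mem_inter, mem_union]
      constructor
      · rintro ⟨hx | hx, hxb⟩
        · exact absurd hxb (Finset.disjoint_left.1 hab (hTa C hC hx))
        · exact hx
      · intro hx; exact ⟨Or.inr hx, hSb D hD hx⟩
    rintro (hmem | hmem)
    · have h1 := (mem_iff_of_determinedBy (b := b) hdA).1 hmem
      rw [hCa] at h1
      exact hTbad C hC h1
    · have h1 := (mem_iff_of_determinedBy (b := a) hdB).1 (by rw [union_comm]; exact hmem)
      rw [hDb] at h1
      exact hSbad D hD h1
  · rw [Set.mem_union, not_or] at hbad
    obtain ⟨hA', hB'⟩ := hbad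
    have h1 : ((a \ (T ∩ a) : Finset ι) : Set ι) ∉ A := fun h => hA' ((mem_iff_of_determinedBy (b := b) hdA).2 h)
    have h2 : ((b \ (T ∩ b) : Finset ι) : Set ι) ∉ B := fun h =>
      hB' (by rw [union_comm]; exact (mem_iff_of_determinedBy (b := a) hdB).2 h)
    obtain ⟨C, hC, hCT⟩ := hTcov (T ∩ a) inter_subset_right h1
    obtain ⟨D, hD, hDT⟩ := hScov (T ∩ b) inter_subset_right h2
    exact ⟨C ∪ D, mem_orFam.2 ⟨C, hC, D, hD, rfl⟩,
      union_subset (hCT.trans inter_subset_left) (hDT.trans inter_subset_left)⟩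

/-- **Disjunction**: cover families on disjoint blocks combine. [this work] -/
theorem covFam_or {a b : Finset ι} (hab : Disjoint a b) {A B : Set (Set ι)} {𝒯 𝒮 : Finset (Finset ι)}
    (hdA : DeterminedBy A (↑a : Set ι)) (hdB : DeterminedBy B (↑b : Set ι))
    (hA : CovFam p a A 𝒯) (hB : CovFam p b B 𝒮) :
    CovFam p (a ∪ b) (A ∪ B) (orFam 𝒯 𝒮) := by
  obtain ⟨hTa, hTbad, hTcov, hTc, hTpos⟩ := hA
  obtain ⟨hSb, hSbad, hScov, hSc, hSpos⟩ := hB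
  obtain ⟨h1, h2, h3⟩ := clauses_or hab hdA hdB hTa hTbad hTcov hSb hSbad hScov
  refine ⟨h1, h2, h3, cover_or p hab hTa hSb hTc hSc hTpos hSpos, ?_⟩
  rw [famIn_or_empty p hab hTa hSb]
  nlinarith [famIn_le_one p a 𝒯 ∅]

end SafeCalc

end Summit.CriticalPhenomena.PercolationContinuityZ3.Theorems.SunflowerPartition
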